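import Summits.MatrixMultiplication.MatrixMultiplication.Theorems.GradedDesignFamily.Negative.SubfieldCellNineLambdaCert

/-!
# Subfield cell `GL₂(𝔽₉) ⊃ SL₂(𝔽₃)` — IV: every embedding `SL₂(𝔽₃) ↪ GL₂(𝔽₉)` is standard

**Honest framing.** A structural lemma about the finite cell `q = 3` of the skeleton line
`quadratic_extension_level_one_cell` (stub S3 `stub_subfieldCell`, crux `GradedDesignFamily`, route
`LevelGradedCohnUmans`); it removes the "standard model" caveat from cell theorems stated for
`φ = mapGL`.  It is **not** summit progress.

## The theorem

`embedding_conj`: every injective group homomorphism `φ : SL₂(𝔽₃) →* GL₂(𝔽₉)`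
(`𝔽₉ = QuadraticAlgebra (ZMod 3) (-1) 0`) is conjugate to the standard one:
`∃ g, ∀ a, φ a = g · mapGL a · g⁻¹`.

## Proof

`SL₂(𝔽₃) = ⟨s, t⟩` with `s = !![0,-1;1,0]`, `t = !![1,1;0,1]` (the 24 elements are the words
`words24`, `sl3_words`).  (1) `φ t` has order `3`, and every element of order `3` of `GL₂(𝔽₉)` is
conjugate to `t` (`fact_conjT`, exhaustive).  (2) After conjugating so that `φ t = t`, the matrix
`S = φ s` satisfies `S⁴ = 1`, `(S t)³ = S²` (relations of `s, t`) and `S² ≠ 1` (injectivity); the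
exhaustive `fact_conjS` says every such `S` is `g s g⁻¹` for some `g` commuting with `t`.  (3) Two
homomorphisms agreeing on `s, t` agree (`hom_eq_of_st`).  The searches run on the integer codes of
file IIb (`mc`, `mulC`; new: `ofMC`, `detC`).
-/

set_option linter.dupNamespace false

namespace Summit.MatrixMultiplication.MatrixMultiplication.Theorems.GradedDesignFamily.Negative.SubfieldNine

open Matrix

/-! ### Generators and words -/

/-- The unipotent generator `t`, as a matrix over `𝔽₉`. -/
def tK : Mat := !![1, 1; 0, 1]

/-- The order-`4` generator `s`, as a matrix over `𝔽₉`. -/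
def sK : Mat := !![0, -1; 1, 0]

/-- `t ∈ SL₂(𝔽₃)`. -/
def tSL : SL3 := ⟨!![1, 1; 0, 1], by decide⟩

/-- `s ∈ SL₂(𝔽₃)`. -/
def sSL : SL3 := ⟨!![0, -1; 1, 0], by decide⟩

/-- `mapGL t = tK`. -/
theorem mapGL_tSL : ((Matrix.SpecialLinearGroup.mapGL K tSL : GL (Fin 2) K) : Mat) = tK := by
  rw [← phiM_eq]; decide

/-- `mapGL s = sK`. -/
theorem mapGL_sSL : ((Matrix.SpecialLinearGroup.mapGL K sSL : GL (Fin 2) K) : Mat) = sK := by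
  rw [← phiM_eq]; decide

/-- Evaluate a word (`false ↦ x`, `true ↦ y`). -/
def evalW {M : Type} [Monoid M] (x y : M) : List Bool → M
  | [] => 1
  | b :: w => (if b then y else x) * evalW x y w

/-- Words in `s, t` for the 24 elements of `SL₂(𝔽₃)`. -/
def words24 : List (List Bool) :=
  [[], [false], [true], [false, false], [true, false], [false, true], [true, true],
   [false, false, false], [true, false, false], [false, true, false], [true, true, false],
   [true, false, true], [false, true, true], [true, false, false, false],
   [false, true, false, false], [true, true, false, false], [false, true, true, false],
   [true, true, false, true], [true, false, true, true], [false, true, false, false, false],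
   [true, true, false, false, false], [false, true, true, false, false],
   [true, false, true, true, false], [false, true, true, false, true]]

/-- Every element of `SL₂(𝔽₃)` is one of the 24 words. -/
theorem sl3_words : ∀ a : SL3, ∃ w ∈ words24, evalW sSL tSL w = a := by native_decide

/-- Homomorphisms commute with word evaluation. -/
theorem map_evalW {M N : Type} [Monoid M] [Monoid N] (f : M →* N) (x y : M) (w : List Bool) :
    f (evalW x y w) = evalW (f x) (f y) w := by
  induction w with
  | nil => simp [evalW]
  | cons b w ih => cases b <;> simp [evalW, ih]

/-- Two homomorphisms out of `SL₂(𝔽₃)` that agree on `s` and `t` are equal. -/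
theorem hom_eq_of_st {N : Type} [Monoid N] (f g : SL3 →* N) (hs : f sSL = g sSL)
    (ht : f tSL = g tSL) : f = g := by
  ext a
  obtain ⟨w, -, rfl⟩ := sl3_words a
  rw [map_evalW, map_evalW, hs, ht]

/-! ### Code-world searches -/

/-- Decode an element of `𝔽₉`. -/
def ofF (c : F9c) : K := ⟨((c.val % 3 : ℕ) : ZMod 3), ((c.val / 3 : ℕ) : ZMod 3)⟩

/-- Decode a matrix. -/
def ofMC : MC → Mat
  | (a, b, c, d) => !![ofF a, ofF b; ofF c, ofF d]

/-- `ofMC` inverts `mc`. -/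
theorem ofMC_mc : ∀ a : Mat, ofMC (mc a) = a := by native_decide

/-- `mc` inverts `ofMC`. -/
theorem mc_ofMC : ∀ c : MC, mc (ofMC c) = c := by native_decide

/-- `mc` is injective. -/
theorem mc_injective : Function.Injective mc := fun a b h => by
  rw [← ofMC_mc a, h, ofMC_mc]

/-- Negation on codes. -/
def knegF (m : F9c) : F9c := ⟨(3 - m.val % 3) % 3 + 3 * ((3 - m.val / 3) % 3), by omega⟩

/-- Determinant on codes. -/
def detC : MC → F9c
  | (a, b, c, d) => kaddF (kmulF a d) (knegF (kmulF b c))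

/-- Bridge for invertibility. -/
theorem fact_detC : ∀ a : Mat, det2 a ≠ 0 ↔ detC (mc a) ≠ kF 0 := by native_decide

/-- Search predicate: `g` is invertible and `g · tK = T · g`. -/
def conjTP (Tc gc : MC) : Bool := (detC gc != kF 0) && (mulC gc (mc tK) == mulC Tc gc)

/-- **Exhaustive fact:** every element of order `3` of `GL₂(𝔽₉)` is conjugate to `tK`. -/
theorem fact_conjT : ∀ T : Mat, det2 T ≠ 0 → T * T * T = 1 → T ≠ 1 →
    (allMC.any fun gc => conjTP (mc T) gc) = true := by
  native_decide

/-- Search predicate: `g` invertible, commutes with `tK`, and `g · sK = S · g`. -/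
def conjSP (Sc gc : MC) : Bool :=
  (detC gc != kF 0) && (mulC gc (mc tK) == mulC (mc tK) gc) && (mulC gc (mc sK) == mulC Sc gc)

/-- **Exhaustive fact:** every `S ∈ GL₂(𝔽₉)` with `S⁴ = 1`, `(S·t)³ = S²`, `S² ≠ 1` is a
`C(t)`-conjugate of `sK` (there are exactly nine such `S`). -/
theorem fact_conjS : ∀ S : Mat, det2 S ≠ 0 → S ^ 4 = 1 → (S * tK) ^ 3 = S ^ 2 → S ^ 2 ≠ 1 →
    (allMC.any fun gc => conjSP (mc S) gc) = true := by
  native_decide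

/-- Unpack a successful code search into a matrix. -/
theorem exists_of_any {P : MC → Bool} (h : (allMC.any P) = true) : ∃ g : Mat, P (mc g) = true := by
  obtain ⟨gc, -, hgc⟩ := List.any_eq_true.1 h
  exact ⟨ofMC gc, by rwa [mc_ofMC]⟩

/-- Read a code identity `mulC (mc a) (mc b) = mulC (mc c) (mc d)` as `a * b = c * d`. -/
theorem mul_eq_of_code {a b c d : Mat} (h : mulC (mc a) (mc b) = mulC (mc c) (mc d)) :
    a * b = c * d := by
  rw [← mc_mul2, ← mc_mul2] at h
  have := mc_injective h
  rwa [mul2_eq, mul2_eq] at this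

/-- A conjugator for an element of order three. -/
theorem exists_conjT (T : Mat) (hT : det2 T ≠ 0) (h3 : T * T * T = 1) (h1 : T ≠ 1) :
    ∃ g : Mat, det2 g ≠ 0 ∧ g * tK = T * g := by
  obtain ⟨g, hg⟩ := exists_of_any (fact_conjT T hT h3 h1)
  simp only [conjTP, Bool.and_eq_true, bne_iff_ne, ne_eq, beq_iff_eq] at hg
  exact ⟨g, (fact_detC g).2 hg.1, mul_eq_of_code hg.2⟩

/-- A `C(t)`-conjugator for a solution of the relations. -/
theorem exists_conjS (S : Mat) (hS : det2 S ≠ 0) (h4 : S ^ 4 = 1) (hst : (S * tK) ^ 3 = S ^ 2)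
    (h2 : S ^ 2 ≠ 1) : ∃ g : Mat, det2 g ≠ 0 ∧ g * tK = tK * g ∧ g * sK = S * g := by
  obtain ⟨g, hg⟩ := exists_of_any (fact_conjS S hS h4 hst h2)
  simp only [conjSP, Bool.and_eq_true, bne_iff_ne, ne_eq, beq_iff_eq] at hg
  exact ⟨g, (fact_detC g).2 hg.1.1, mul_eq_of_code hg.1.2, mul_eq_of_code hg.2⟩

/-! ### The classification -/

/-- Determinant of (the matrix of) an element of `GL₂(𝔽₉)` is non-zero, `det2` form. -/
theorem det2_coe_ne_zero (g : GL (Fin 2) K) : det2 (g : Mat) ≠ 0 := by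
  rw [det2_eq]
  exact ((Matrix.isUnit_iff_isUnit_det _).1 g.isUnit).ne_zero

/-- **Every embedding `SL₂(𝔽₃) ↪ GL₂(𝔽₉)` is conjugate to the standard one.** -/
theorem embedding_conj (φ : SL3 →* GL (Fin 2) K) (hφ : Function.Injective φ) :
    ∃ g : GL (Fin 2) K, ∀ a : SL3, φ a = g * Matrix.SpecialLinearGroup.mapGL K a * g⁻¹ := by
  have ht3 : tSL * tSL * tSL = 1 := by decide
  have ht1 : tSL ≠ 1 := by decide
  have hs4 : sSL ^ 4 = 1 := by decide
  have hst : (sSL * tSL) ^ 3 = sSL ^ 2 := by decide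
  have hs2 : sSL ^ 2 ≠ 1 := by decide
  -- step 1: conjugate `φ t` to `tK`
  set T := φ tSL with hTdef
  have hT3 : (T : Mat) * T * T = 1 := by
    have h := congrArg (fun x : GL (Fin 2) K => (x : Mat)) (show T * T * T = 1 by
      rw [hTdef, ← map_mul, ← map_mul, ht3, map_one])
    simpa using h
  have hT1 : (T : Mat) ≠ 1 := by
    intro h
    apply ht1
    apply hφ
    rw [map_one]
    exact Units.ext h
  obtain ⟨g₁, hg₁, hg₁t⟩ := exists_conjT (T : Mat) (det2_coe_ne_zero T) hT3 hT1
  let G₁ : GL (Fin 2) K := Matrix.GeneralLinearGroup.mkOfDetNeZero g₁ (by rwa [← det2_eq])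
  have hG₁ : (G₁ : Mat) = g₁ := rfl
  -- the conjugated homomorphism
  let φ₁ : SL3 →* GL (Fin 2) K := (MulAut.conj G₁⁻¹).toMonoidHom.comp φ
  have hφ₁ : ∀ a, φ₁ a = G₁⁻¹ * φ a * G₁ := by
    intro a; simp [φ₁]
  have hφ₁inj : Function.Injective φ₁ :=
    (MulAut.conj G₁⁻¹).injective.comp hφ
  have hg₁t' : (G₁ : Mat) * tK = (T : Mat) * G₁ := by rw [hG₁]; exact hg₁t
  have hφ₁t : φ₁ tSL = Matrix.SpecialLinearGroup.mapGL K tSL := by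
    apply Units.ext
    rw [mapGL_tSL, hφ₁, Units.val_mul, Units.val_mul, ← hTdef, _root_.mul_assoc, ← hg₁t',
      ← _root_.mul_assoc, Units.inv_mul, _root_.one_mul]
  -- step 2: the image of `s`
  set S := φ₁ sSL with hSdef
  have hval : ∀ (x : GL (Fin 2) K) (n : ℕ), ((x ^ n : GL (Fin 2) K) : Mat) = (x : Mat) ^ n :=
    fun x n => Units.val_pow_eq_pow_val x n
  have hS4 : (S : Mat) ^ 4 = 1 := by
    rw [← hval, hSdef, ← map_pow, hs4, map_one, Units.val_one]
  have hSt : ((S : Mat) * tK) ^ 3 = (S : Mat) ^ 2 := by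
    rw [← mapGL_tSL, ← hφ₁t, ← Units.val_mul, ← hval, ← hval, hSdef, ← map_mul, ← map_pow,
      ← map_pow, hst]
  have hS2 : (S : Mat) ^ 2 ≠ 1 := by
    intro h
    apply hs2
    apply hφ₁inj
    rw [map_pow, map_one]
    exact Units.ext (by rw [hval]; exact h)
  obtain ⟨g₂, hg₂, hg₂t, hg₂s⟩ := exists_conjS (S : Mat) (det2_coe_ne_zero S) hS4 hSt hS2
  let G₂ : GL (Fin 2) K := Matrix.GeneralLinearGroup.mkOfDetNeZero g₂ (by rwa [← det2_eq])
  have hG₂ : (G₂ : Mat) = g₂ := rfl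
  -- step 3: `φ₁` is conjugation by `G₂` composed with `mapGL`
  let ψ : SL3 →* GL (Fin 2) K := (MulAut.conj G₂).toMonoidHom.comp (Matrix.SpecialLinearGroup.mapGL K)
  have hψ : ∀ a, ψ a = G₂ * Matrix.SpecialLinearGroup.mapGL K a * G₂⁻¹ := by
    intro a; simp [ψ, MulAut.conj_apply]
  have hconj : ∀ (x y : GL (Fin 2) K), g₂ * (y : Mat) = (x : Mat) * g₂ → x = G₂ * y * G₂⁻¹ := by
    intro x y h
    have h' : x * G₂ = G₂ * y := Units.ext (by rw [Units.val_mul, Units.val_mul, hG₂, h])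
    rw [← h', mul_inv_cancel_right]
  have heq : φ₁ = ψ := by
    apply hom_eq_of_st
    · rw [hψ, ← hSdef]
      exact hconj S _ (by rw [mapGL_sSL, hg₂s])
    · rw [hψ, hφ₁t]
      exact hconj _ _ (by rw [mapGL_tSL, hg₂t])
  refine ⟨G₁ * G₂, fun a => ?_⟩
  have h1 : φ a = G₁ * φ₁ a * G₁⁻¹ := by rw [hφ₁]; group
  rw [h1, heq, hψ]
  group

end Summit.MatrixMultiplication.MatrixMultiplication.Theorems.GradedDesignFamily.Negative.SubfieldNine
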